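import Literature.Analysis.PDE.MollifierL2
import Mathlib.Analysis.Calculus.BumpFunction.Convolution
import HarnessLib

/-!
# The rate of mollification: `‖τ_t h − h‖₂ ≤ ‖t‖ Σⱼ ‖∂ⱼ h‖₂` and
# `‖φ.normed ⋆ h − h‖₂ ≤ r_out Σⱼ ‖∂ⱼ h‖₂`; sup-norm companions (topic `Analysis/PDE`)

Analytic layer of the energy-method existence theory for linear first-order symmetric hyperbolic
systems (Friedrichs 1954), built to discharge the named fact
`Literature.Geometry.Lorentzian.KerrSchild.waveCauchyProblem`. The convergence of Friedrichs'
regularisation `∂ₜU = J_ε 𝒫 J_ε U` as `ε → 0` rests on a *rate* for `J_ε h → h` which is uniform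
over bounded sets of `H¹`: the classical estimates (Adams, *Sobolev Spaces*, Lemma 2.18 and the
proof of Thm. 2.29; Evans, *PDE*, §5.8.2, Thm. 3 (i), proof: `‖u(· + h) − u‖_{L²} ≤ |h| ‖Du‖_{L²}`)

* `eLpNorm_sub_translate_le` — **translations**: for `h ∈ C¹(ℝⁿ; W)`,
  `‖h(· − t) − h‖₂ ≤ ‖t‖ · Σⱼ ‖∂ⱼ h‖₂` (`h(x − t) − h(x) = −∫₀¹ Dh(x − st) t ds`, Cauchy–Schwarz on
  `[0, 1]`, Tonelli and the translation invariance of Lebesgue measure);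
* `l2norm_normed_convolution_sub_self_le` — **mollification**: for a bump `φ` centred at `0`,
  `‖φ.normed ⋆ h − h‖₂ ≤ φ.rOut · Σⱼ ‖∂ⱼ h‖₂` (`(φ.normed ⋆ h − h)(x) = ∫ φ.normed(t) (h(x − t) − h(x)) dt`,
  Cauchy–Schwarz against the unit-mass kernel, Tonelli, and the translation estimate on the
  support `‖t‖ ≤ r_out`);
* `norm_normed_convolution_sub_self_le`, `norm_normed_convolution_le` — the elementary sup-norm
  companions (Mathlib's `ContDiffBump.dist_normed_convolution_le` and the mean value inequality).

Everything is proved; no named fact and no `sorry` is introduced.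

## References

* R. A. Adams, *Sobolev Spaces*, Academic Press 1975, Lemma 2.18 and Thm. 2.29. [Adams1975]
* L. C. Evans, *Partial Differential Equations*, 2nd ed., AMS 2010, §5.8.2, Thm. 3 and App. C.4,
  Thm. 7. [Evans2010]
* K. O. Friedrichs, Comm. Pure Appl. Math. 7 (1954) 345–392. [Friedrichs1954]
-/

noncomputable section

open MeasureTheory Set Function Filter Metric ContinuousLinearMap
open scoped ContDiff Topology RealInnerProductSpace ENNReal NNReal Convolution

namespace Literature.Analysis.PDE

open Literature.Analysis.FunctionSpaces

variable {ι : Type*} [Fintype ι] [DecidableEq ι]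
variable {W : Type*} [NormedAddCommGroup W] [NormedSpace ℝ W]

/-! ### Cauchy–Schwarz in the two forms used -/

omit [DecidableEq ι] in
/-- **Cauchy–Schwarz against a nonnegative weight**: for continuous compactly supported `ρ ≥ 0`
and continuous `a ≥ 0`, `(∫ ρ a)² ≤ (∫ ρ) · ∫ ρ a²` (Hölder with exponents `2, 2` for `√ρ` and
`√ρ · a`). [folklore] -/
theorem sq_integral_weight_mul_le {ρ a : EuclideanSpace ℝ ι → ℝ} (hρ : Continuous ρ)
    (hρc : HasCompactSupport ρ) (hρ0 : ∀ t, 0 ≤ ρ t) (ha : Continuous a) (ha0 : ∀ t, 0 ≤ a t) :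
    (∫ t, ρ t * a t) ^ 2 ≤ (∫ t, ρ t) * ∫ t, ρ t * a t ^ 2 := by
  set f : EuclideanSpace ℝ ι → ℝ := fun t ↦ Real.sqrt (ρ t) with hf
  set g : EuclideanSpace ℝ ι → ℝ := fun t ↦ Real.sqrt (ρ t) * a t with hg
  have hfc : Continuous f := Real.continuous_sqrt.comp hρ
  have hgc : Continuous g := hfc.mul ha
  have hfs : HasCompactSupport f := by
    refine hρc.mono fun t ht ↦ ?_
    simp only [mem_support, ne_eq, hf] at ht ⊢
    intro h0; exact ht (by rw [h0, Real.sqrt_zero])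
  have hgs : HasCompactSupport g := hfs.mul_right
  have hf2 : MemLp f (ENNReal.ofReal 2) (volume : Measure (EuclideanSpace ℝ ι)) := by
    rw [ENNReal.ofReal_ofNat]; exact hfc.memLp_of_hasCompactSupport hfs
  have hg2 : MemLp g (ENNReal.ofReal 2) (volume : Measure (EuclideanSpace ℝ ι)) := by
    rw [ENNReal.ofReal_ofNat]; exact hgc.memLp_of_hasCompactSupport hgs
  have hH := integral_mul_le_Lp_mul_Lq_of_nonneg (μ := (volume : Measure (EuclideanSpace ℝ ι)))
    Real.HolderConjugate.two_two (Eventually.of_forall fun t ↦ Real.sqrt_nonneg _)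
    (Eventually.of_forall fun t ↦ mul_nonneg (Real.sqrt_nonneg _) (ha0 t)) hf2 hg2
  have hfg : (fun t ↦ f t * g t) = fun t ↦ ρ t * a t := by
    funext t; simp only [hf, hg]
    rw [← mul_assoc, Real.mul_self_sqrt (hρ0 t)]
  have hff : (fun t ↦ f t ^ (2 : ℝ)) = ρ := by
    funext t; simp only [hf]; rw [Real.rpow_two, Real.sq_sqrt (hρ0 t)]
  have hgg : (fun t ↦ g t ^ (2 : ℝ)) = fun t ↦ ρ t * a t ^ 2 := by
    funext t; simp only [hg]; rw [Real.rpow_two, mul_pow, Real.sq_sqrt (hρ0 t)]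
  rw [hfg, hff, hgg] at hH
  have hI0 : 0 ≤ ∫ t, ρ t := integral_nonneg hρ0
  have hJ0 : 0 ≤ ∫ t, ρ t * a t ^ 2 := integral_nonneg fun t ↦ mul_nonneg (hρ0 t) (sq_nonneg _)
  have hK0 : 0 ≤ ∫ t, ρ t * a t := integral_nonneg fun t ↦ mul_nonneg (hρ0 t) (ha0 t)
  calc (∫ t, ρ t * a t) ^ 2
      ≤ ((∫ t, ρ t) ^ (1 / (2 : ℝ)) * (∫ t, ρ t * a t ^ 2) ^ (1 / (2 : ℝ))) ^ 2 :=
        pow_le_pow_left₀ hK0 hH 2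
    _ = ((∫ t, ρ t) ^ (1 / (2 : ℝ))) ^ 2 * ((∫ t, ρ t * a t ^ 2) ^ (1 / (2 : ℝ))) ^ 2 := mul_pow _ _ _
    _ = (∫ t, ρ t) * ∫ t, ρ t * a t ^ 2 := by
        rw [← Real.sqrt_eq_rpow, ← Real.sqrt_eq_rpow, Real.sq_sqrt hI0, Real.sq_sqrt hJ0]

omit [Fintype ι] [DecidableEq ι] in
/-- **Cauchy–Schwarz on `[0, 1]`**: `(∫₀¹ a)² ≤ ∫₀¹ a²` for continuous `a` (variance is
nonnegative: `0 ≤ ∫₀¹ (a − m)² = ∫₀¹ a² − m²`, `m = ∫₀¹ a`). [folklore] -/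
theorem sq_integral_unit_interval_le {a : ℝ → ℝ} (ha : Continuous a) :
    (∫ s in (0 : ℝ)..1, a s) ^ 2 ≤ ∫ s in (0 : ℝ)..1, a s ^ 2 := by
  set m : ℝ := ∫ s in (0 : ℝ)..1, a s with hm
  have h0 : 0 ≤ ∫ s in (0 : ℝ)..1, (a s - m) ^ 2 :=
    intervalIntegral.integral_nonneg zero_le_one fun s _ ↦ sq_nonneg _
  have hia : IntervalIntegrable a volume 0 1 := ha.intervalIntegrable _ _
  have hia2 : IntervalIntegrable (fun s ↦ a s ^ 2) volume 0 1 := (ha.pow 2).intervalIntegrable _ _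
  have hexp : (∫ s in (0 : ℝ)..1, (a s - m) ^ 2) =
      (∫ s in (0 : ℝ)..1, a s ^ 2) - 2 * m * (∫ s in (0 : ℝ)..1, a s) + m ^ 2 := by
    have h1 : (fun s ↦ (a s - m) ^ 2) = fun s ↦ (a s ^ 2 - (2 * m) * a s) + m ^ 2 := by
      funext s; ring
    rw [h1, intervalIntegral.integral_add (hia2.sub (hia.const_mul _)) (intervalIntegrable_const),
      intervalIntegral.integral_sub hia2 (hia.const_mul _), intervalIntegral.integral_const_mul,
      intervalIntegral.integral_const]
    simp
  rw [hexp, ← hm] at h0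
  nlinarith [h0]

/-! ### The gradient bound `‖Dh(y) t‖ ≤ ‖t‖ Σⱼ ‖∂ⱼ h (y)‖` -/

/-- The sum of the norms of the partial derivatives, `G(y) = Σⱼ ‖∂ⱼ h (y)‖`. [folklore] -/
def gradSum (h : EuclideanSpace ℝ ι → W) (y : EuclideanSpace ℝ ι) : ℝ :=
  ∑ j, ‖fderiv ℝ h y (bv j)‖

omit [DecidableEq ι] in
/-- `0 ≤ G(y)`. [folklore] -/
theorem gradSum_nonneg (h : EuclideanSpace ℝ ι → W) (y : EuclideanSpace ℝ ι) : 0 ≤ gradSum h y :=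
  Finset.sum_nonneg fun _ _ ↦ norm_nonneg _

omit [DecidableEq ι] in
/-- `G` is continuous for `h ∈ C¹`. [folklore] -/
theorem continuous_gradSum {h : EuclideanSpace ℝ ι → W} (hh : ContDiff ℝ 1 h) :
    Continuous (gradSum h) :=
  continuous_finsetSum _ fun _ _ ↦ ((hh.continuous_fderiv one_ne_zero).clm_apply continuous_const).norm

omit [DecidableEq ι] in
/-- **Directional derivatives are controlled by the partial derivatives**:
`‖Dh(y) t‖ ≤ ‖t‖ Σⱼ ‖∂ⱼ h (y)‖` (`t = Σⱼ tⱼ 𝐞ⱼ`, `|tⱼ| ≤ ‖t‖`). [folklore] -/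
theorem norm_fderiv_apply_le_gradSum (h : EuclideanSpace ℝ ι → W) (y t : EuclideanSpace ℝ ι) :
    ‖fderiv ℝ h y t‖ ≤ ‖t‖ * gradSum h y := by
  have ht : t = ∑ j, t j • (bv j : EuclideanSpace ℝ ι) := by
    conv_lhs => rw [← (EuclideanSpace.basisFun ι ℝ).sum_repr t]
    simp [bv_def]
  calc ‖fderiv ℝ h y t‖ = ‖∑ j, t j • fderiv ℝ h y (bv j)‖ := by
        conv_lhs => rw [ht]
        rw [map_sum]
        simp only [map_smul]
    _ ≤ ∑ j, ‖t j • fderiv ℝ h y (bv j)‖ := norm_sum_le _ _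
    _ ≤ ∑ j, ‖t‖ * ‖fderiv ℝ h y (bv j)‖ := Finset.sum_le_sum fun j _ ↦ by
        rw [norm_smul]
        exact mul_le_mul_of_nonneg_right (by simpa using PiLp.norm_apply_le t j) (norm_nonneg _)
    _ = ‖t‖ * gradSum h y := by rw [gradSum, Finset.mul_sum]

/-! ### Translations: `‖h(· − t) − h‖₂ ≤ ‖t‖ Σⱼ ‖∂ⱼ h‖₂` -/

section Translate

variable [CompleteSpace W]

omit [DecidableEq ι] in
/-- **Pointwise mean value estimate along the segment**:
`‖h(x − t) − h(x)‖ ≤ ‖t‖ ∫₀¹ G(x − s t) ds` for `h ∈ C¹`. [cite: Evans2010, §5.8.2 Thm. 3] -/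
theorem norm_sub_translate_le {h : EuclideanSpace ℝ ι → W} (hh : ContDiff ℝ 1 h)
    (x t : EuclideanSpace ℝ ι) :
    ‖h (x - t) - h x‖ ≤ ‖t‖ * ∫ s in (0 : ℝ)..1, gradSum h (x - s • t) := by
  -- the path `γ s = h (x - s • t)` and its derivative
  have hderiv : ∀ s, HasDerivAt (fun r : ℝ ↦ h (x - r • t)) (-(fderiv ℝ h (x - s • t) t)) s := by
    intro s
    have h1 : HasDerivAt (fun r : ℝ ↦ x - r • t) (-t) s := by
      simpa using ((hasDerivAt_id s).smul_const t).const_sub x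
    have h2 : HasDerivAt (fun r : ℝ ↦ h (x - r • t)) (fderiv ℝ h (x - s • t) (-t)) s :=
      ((hh.differentiable one_ne_zero (x - s • t)).hasFDerivAt).comp_hasDerivAt s h1
    simpa using h2
  have hc : Continuous fun s : ℝ ↦ x - s • t := by fun_prop
  have hcont : Continuous fun s ↦ -(fderiv ℝ h (x - s • t) t) :=
    (((hh.continuous_fderiv one_ne_zero).comp hc).clm_apply continuous_const).neg
  have hFTC := intervalIntegral.integral_eq_sub_of_hasDerivAt (a := (0 : ℝ)) (b := 1)
    (fun s _ ↦ hderiv s) (hcont.intervalIntegrable _ _)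
  simp only [one_smul, zero_smul, sub_zero] at hFTC
  rw [← hFTC]
  have hGc : Continuous fun s ↦ gradSum h (x - s • t) := (continuous_gradSum hh).comp hc
  calc ‖∫ s in (0 : ℝ)..1, -(fderiv ℝ h (x - s • t) t)‖
      ≤ ∫ s in (0 : ℝ)..1, ‖-(fderiv ℝ h (x - s • t) t)‖ :=
        intervalIntegral.norm_integral_le_integral_norm zero_le_one
    _ ≤ ∫ s in (0 : ℝ)..1, ‖t‖ * gradSum h (x - s • t) := by
        refine intervalIntegral.integral_mono_on zero_le_one (hcont.norm.intervalIntegrable _ _)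
          ((continuous_const.mul hGc).intervalIntegrable _ _) fun s _ ↦ ?_
        rw [norm_neg]
        exact norm_fderiv_apply_le_gradSum h _ t
    _ = ‖t‖ * ∫ s in (0 : ℝ)..1, gradSum h (x - s • t) := by
        rw [intervalIntegral.integral_const_mul]

omit [DecidableEq ι] in
/-- Squared pointwise estimate: `‖h(x − t) − h(x)‖² ≤ ‖t‖² ∫₀¹ G(x − s t)² ds`
(Cauchy–Schwarz on `[0, 1]`). [cite: Evans2010, §5.8.2 Thm. 3] -/
theorem norm_sub_translate_sq_le {h : EuclideanSpace ℝ ι → W} (hh : ContDiff ℝ 1 h)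
    (x t : EuclideanSpace ℝ ι) :
    ‖h (x - t) - h x‖ ^ 2 ≤ ‖t‖ ^ 2 * ∫ s in (0 : ℝ)..1, gradSum h (x - s • t) ^ 2 := by
  have hc : Continuous fun s : ℝ ↦ x - s • t := by fun_prop
  have hGc : Continuous fun s ↦ gradSum h (x - s • t) := (continuous_gradSum hh).comp hc
  have h1 := norm_sub_translate_le hh x t
  have hI0 : 0 ≤ ∫ s in (0 : ℝ)..1, gradSum h (x - s • t) :=
    intervalIntegral.integral_nonneg zero_le_one fun s _ ↦ gradSum_nonneg h _
  calc ‖h (x - t) - h x‖ ^ 2 ≤ (‖t‖ * ∫ s in (0 : ℝ)..1, gradSum h (x - s • t)) ^ 2 :=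
        pow_le_pow_left₀ (norm_nonneg _) h1 2
    _ = ‖t‖ ^ 2 * (∫ s in (0 : ℝ)..1, gradSum h (x - s • t)) ^ 2 := by ring
    _ ≤ ‖t‖ ^ 2 * ∫ s in (0 : ℝ)..1, gradSum h (x - s • t) ^ 2 :=
        mul_le_mul_of_nonneg_left (sq_integral_unit_interval_le hGc) (sq_nonneg _)

omit [Fintype ι] [DecidableEq ι] in
/-- `‖w‖ₑ² = ofReal (‖w‖²)`. [folklore] -/
theorem enorm_sq_eq_ofReal_norm_sq {V : Type*} [NormedAddCommGroup V] (w : V) :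
    ‖w‖ₑ ^ 2 = ENNReal.ofReal (‖w‖ ^ 2) := by
  rw [← ofReal_norm, ENNReal.ofReal_pow (norm_nonneg _)]

omit [DecidableEq ι] in
/-- **The integrated translation estimate, `ℝ≥0∞` form**:
`∫ ‖h(x − t) − h(x)‖² dx ≤ ‖t‖² ∫ G²` (Tonelli over `[0, 1] × ℝⁿ` and the translation invariance of
Lebesgue measure). [cite: Evans2010, §5.8.2 Thm. 3] -/
theorem lintegral_enorm_sub_translate_sq_le {h : EuclideanSpace ℝ ι → W} (hh : ContDiff ℝ 1 h)
    (t : EuclideanSpace ℝ ι) :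
    ∫⁻ x, ‖h (x - t) - h x‖ₑ ^ 2 ∂(volume : Measure (EuclideanSpace ℝ ι)) ≤
      ENNReal.ofReal (‖t‖ ^ 2) *
        ∫⁻ x, ENNReal.ofReal (gradSum h x ^ 2) ∂(volume : Measure (EuclideanSpace ℝ ι)) := by
  set μ : Measure (EuclideanSpace ℝ ι) := volume with hμ
  have hG : Continuous (gradSum h) := continuous_gradSum hh
  -- pointwise, in `ℝ≥0∞`
  have hpt : ∀ x, ‖h (x - t) - h x‖ₑ ^ 2 ≤ ENNReal.ofReal (‖t‖ ^ 2) *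
      ∫⁻ s in Ioc (0 : ℝ) 1, ENNReal.ofReal (gradSum h (x - s • t) ^ 2) := by
    intro x
    have hc : Continuous fun s : ℝ ↦ x - s • t := by fun_prop
    have hGc : Continuous fun s ↦ gradSum h (x - s • t) := hG.comp hc
    rw [enorm_sq_eq_ofReal_norm_sq]
    have h1 := norm_sub_translate_sq_le hh x t
    have hint : IntegrableOn (fun s ↦ gradSum h (x - s • t) ^ 2) (Ioc (0 : ℝ) 1) volume :=
      ((hGc.pow 2).integrableOn_Icc).mono_set Ioc_subset_Icc_self
    have heq : (∫ s in (0 : ℝ)..1, gradSum h (x - s • t) ^ 2) =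
        (∫⁻ s in Ioc (0 : ℝ) 1, ENNReal.ofReal (gradSum h (x - s • t) ^ 2)).toReal := by
      rw [intervalIntegral.integral_of_le zero_le_one, integral_eq_lintegral_of_nonneg_ae
        (Eventually.of_forall fun s ↦ sq_nonneg _) (hGc.pow 2).aestronglyMeasurable]
    rw [heq] at h1
    calc ENNReal.ofReal (‖h (x - t) - h x‖ ^ 2)
        ≤ ENNReal.ofReal (‖t‖ ^ 2 *
            (∫⁻ s in Ioc (0 : ℝ) 1, ENNReal.ofReal (gradSum h (x - s • t) ^ 2)).toReal) :=
          ENNReal.ofReal_le_ofReal h1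
      _ = ENNReal.ofReal (‖t‖ ^ 2) *
            ENNReal.ofReal ((∫⁻ s in Ioc (0 : ℝ) 1, ENNReal.ofReal (gradSum h (x - s • t) ^ 2)).toReal) :=
          ENNReal.ofReal_mul (sq_nonneg _)
      _ ≤ ENNReal.ofReal (‖t‖ ^ 2) *
            ∫⁻ s in Ioc (0 : ℝ) 1, ENNReal.ofReal (gradSum h (x - s • t) ^ 2) :=
          mul_le_mul_right ENNReal.ofReal_toReal_le _
  -- integrate and swap
  set g : EuclideanSpace ℝ ι → ℝ → ℝ≥0∞ := fun x s ↦ ENNReal.ofReal (gradSum h (x - s • t) ^ 2) with hg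
  set ν : Measure ℝ := volume.restrict (Ioc (0 : ℝ) 1) with hν
  have hmeas : AEMeasurable (uncurry g) (μ.prod ν) := by
    have hc : Continuous fun p : EuclideanSpace ℝ ι × ℝ ↦ ENNReal.ofReal (gradSum h (p.1 - p.2 • t) ^ 2) := by
      refine ENNReal.continuous_ofReal.comp ((hG.comp ?_).pow 2)
      fun_prop
    exact hc.aemeasurable
  have hpt' : ∀ x, ‖h (x - t) - h x‖ₑ ^ 2 ≤ ENNReal.ofReal (‖t‖ ^ 2) * ∫⁻ s, g x s ∂ν := hpt
  calc ∫⁻ x, ‖h (x - t) - h x‖ₑ ^ 2 ∂μ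
      ≤ ∫⁻ x, ENNReal.ofReal (‖t‖ ^ 2) * ∫⁻ s, g x s ∂ν ∂μ := lintegral_mono hpt'
    _ = ENNReal.ofReal (‖t‖ ^ 2) * ∫⁻ x, ∫⁻ s, g x s ∂ν ∂μ := by
        rw [lintegral_const_mul' _ _ ENNReal.ofReal_ne_top]
    _ = ENNReal.ofReal (‖t‖ ^ 2) * ∫⁻ s, ∫⁻ x, g x s ∂μ ∂ν := by
        rw [lintegral_lintegral_swap hmeas]
    _ = ENNReal.ofReal (‖t‖ ^ 2) * ∫⁻ _s, ∫⁻ x, ENNReal.ofReal (gradSum h x ^ 2) ∂μ ∂ν := by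
        congr 1
        refine lintegral_congr fun s ↦ ?_
        exact lintegral_sub_right_eq_self (fun x ↦ ENNReal.ofReal (gradSum h x ^ 2)) (s • t)
    _ = ENNReal.ofReal (‖t‖ ^ 2) * ∫⁻ x, ENNReal.ofReal (gradSum h x ^ 2) ∂μ := by
        rw [lintegral_const, hν, Measure.restrict_apply_univ, Real.volume_Ioc]
        simp

omit [DecidableEq ι] [CompleteSpace W] in
/-- `∫ ofReal (G²) = ‖G‖₂²`. [folklore] -/
theorem lintegral_ofReal_gradSum_sq {h : EuclideanSpace ℝ ι → W} :
    ∫⁻ x, ENNReal.ofReal (gradSum h x ^ 2) ∂(volume : Measure (EuclideanSpace ℝ ι)) =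
      eLpNorm (gradSum h) 2 (volume : Measure (EuclideanSpace ℝ ι)) ^ 2 := by
  have h2 : eLpNorm (gradSum h) 2 (volume : Measure (EuclideanSpace ℝ ι)) ^ ((2 : ℝ≥0) : ℝ) =
      ∫⁻ x, ‖gradSum h x‖ₑ ^ ((2 : ℝ≥0) : ℝ) ∂(volume : Measure (EuclideanSpace ℝ ι)) :=
    eLpNorm_nnreal_pow_eq_lintegral two_ne_zero
  have h2' : ((2 : ℝ≥0) : ℝ) = 2 := by norm_num
  rw [h2'] at h2
  simp only [ENNReal.rpow_two] at h2
  rw [h2]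
  refine lintegral_congr fun x ↦ ?_
  rw [enorm_sq_eq_ofReal_norm_sq, Real.norm_of_nonneg (gradSum_nonneg h x)]

omit [DecidableEq ι] [CompleteSpace W] in
/-- `‖G‖₂ ≤ Σⱼ ‖∂ⱼ h‖₂`. [folklore] -/
theorem eLpNorm_gradSum_le {h : EuclideanSpace ℝ ι → W} (hh : ContDiff ℝ 1 h) :
    eLpNorm (gradSum h) 2 (volume : Measure (EuclideanSpace ℝ ι)) ≤
      ∑ j, eLpNorm (fun y ↦ fderiv ℝ h y (bv j)) 2 (volume : Measure (EuclideanSpace ℝ ι)) := by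
  have hmeas : ∀ j ∈ (Finset.univ : Finset ι), AEStronglyMeasurable
      (fun y ↦ ‖fderiv ℝ h y (bv j)‖) (volume : Measure (EuclideanSpace ℝ ι)) := fun j _ ↦
    ((hh.continuous_fderiv one_ne_zero).clm_apply continuous_const).norm.aestronglyMeasurable
  have heq : gradSum h = ∑ j, fun y ↦ ‖fderiv ℝ h y (bv j)‖ := by
    funext y; simp [gradSum]
  rw [heq]
  refine (eLpNorm_sum_le hmeas one_le_two).trans (Finset.sum_le_sum fun j _ ↦ ?_)
  rw [eLpNorm_norm]

/-- `a² ≤ b²` implies `a ≤ b` in `ℝ≥0∞`. [folklore] -/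
theorem ENNReal.le_of_sq_le_sq {a b : ℝ≥0∞} (h : a ^ 2 ≤ b ^ 2) : a ≤ b :=
  (ENNReal.pow_le_pow_left_iff two_ne_zero).1 h

omit [DecidableEq ι] in
/-- **The translation estimate** (Evans, *PDE*, §5.8.2, Thm. 3 (i), proof; Brezis, Prop. 9.3):
for `h ∈ C¹(ℝⁿ; W)`, `‖h(· − t) − h‖_{L²} ≤ ‖t‖ · Σⱼ ‖∂ⱼ h‖_{L²}` (in `ℝ≥0∞`, so that no
integrability hypothesis is needed). [cite: Evans2010, §5.8.2 Thm. 3] -/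
theorem eLpNorm_sub_translate_le {h : EuclideanSpace ℝ ι → W} (hh : ContDiff ℝ 1 h)
    (t : EuclideanSpace ℝ ι) :
    eLpNorm (fun x ↦ h (x - t) - h x) 2 (volume : Measure (EuclideanSpace ℝ ι)) ≤
      ENNReal.ofReal ‖t‖ *
        ∑ j, eLpNorm (fun y ↦ fderiv ℝ h y (bv j)) 2 (volume : Measure (EuclideanSpace ℝ ι)) := by
  have h1 := lintegral_enorm_sub_translate_sq_le hh t
  rw [lintegral_ofReal_gradSum_sq] at h1
  have hsq : eLpNorm (fun x ↦ h (x - t) - h x) 2 (volume : Measure (EuclideanSpace ℝ ι)) ^ 2 ≤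
      (ENNReal.ofReal ‖t‖ * eLpNorm (gradSum h) 2 (volume : Measure (EuclideanSpace ℝ ι))) ^ 2 := by
    have h2 : eLpNorm (fun x ↦ h (x - t) - h x) 2 (volume : Measure (EuclideanSpace ℝ ι)) ^ ((2 : ℝ≥0) : ℝ) =
        ∫⁻ x, ‖h (x - t) - h x‖ₑ ^ ((2 : ℝ≥0) : ℝ) ∂(volume : Measure (EuclideanSpace ℝ ι)) :=
      eLpNorm_nnreal_pow_eq_lintegral two_ne_zero
    have h2' : ((2 : ℝ≥0) : ℝ) = 2 := by norm_num
    rw [h2'] at h2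
    simp only [ENNReal.rpow_two] at h2
    rw [h2, mul_pow, ← ENNReal.ofReal_pow (norm_nonneg _)]
    exact h1
  exact (ENNReal.le_of_sq_le_sq hsq).trans (mul_le_mul_right (eLpNorm_gradSum_le hh) _)

end Translate

/-! ### Mollification: `‖φ.normed ⋆ h − h‖₂ ≤ r_out Σⱼ ‖∂ⱼ h‖₂` -/

section Mollify

variable [CompleteSpace W]

omit [DecidableEq ι] in
/-- The mollification error as an integral against the kernel:
`(φ.normed ⋆ h)(x) − h(x) = ∫ φ.normed(t) (h(x − t) − h(x)) dt` (unit mass). [cite: Evans2010, App. C.4 Thm. 7] -/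
theorem normed_convolution_sub_self_eq (φ : ContDiffBump (0 : EuclideanSpace ℝ ι))
    {h : EuclideanSpace ℝ ι → W} (hh : Continuous h) (x : EuclideanSpace ℝ ι) :
    (φ.normed volume ⋆[lsmul ℝ ℝ, volume] h) x - h x =
      ∫ t, φ.normed volume t • (h (x - t) - h x) := by
  have hρ : Continuous (φ.normed (volume : Measure (EuclideanSpace ℝ ι))) :=
    (φ.contDiff_normed (n := 0)).continuous
  have hρc := φ.hasCompactSupport_normed (μ := (volume : Measure (EuclideanSpace ℝ ι)))
  have hint1 : Integrable (fun t ↦ φ.normed volume t • h (x - t)) (volume : Measure (EuclideanSpace ℝ ι)) :=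
    (hρ.smul (hh.comp (continuous_const.sub continuous_id))).integrable_of_hasCompactSupport
      hρc.smul_right
  have hint2 : Integrable (fun t ↦ φ.normed volume t • h x) (volume : Measure (EuclideanSpace ℝ ι)) :=
    φ.integrable_normed.smul_const _
  rw [convolution_def]
  simp only [lsmul_apply, smul_sub]
  rw [integral_sub hint1 hint2, integral_smul_const, φ.integral_normed, one_smul]

omit [DecidableEq ι] in
/-- **Pointwise bound for the mollification error**:
`‖(φ.normed ⋆ h)(x) − h(x)‖² ≤ ∫ φ.normed(t) ‖h(x − t) − h(x)‖² dt` (Cauchy–Schwarz against the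
unit-mass kernel). [cite: Evans2010, App. C.4 Thm. 7] -/
theorem norm_normed_convolution_sub_self_sq_le (φ : ContDiffBump (0 : EuclideanSpace ℝ ι))
    {h : EuclideanSpace ℝ ι → W} (hh : Continuous h) (x : EuclideanSpace ℝ ι) :
    ‖(φ.normed volume ⋆[lsmul ℝ ℝ, volume] h) x - h x‖ ^ 2 ≤
      ∫ t, φ.normed volume t * ‖h (x - t) - h x‖ ^ 2 := by
  have hρ : Continuous (φ.normed (volume : Measure (EuclideanSpace ℝ ι))) :=
    (φ.contDiff_normed (n := 0)).continuous
  have hρc := φ.hasCompactSupport_normed (μ := (volume : Measure (EuclideanSpace ℝ ι)))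
  have ha : Continuous fun t ↦ ‖h (x - t) - h x‖ :=
    ((hh.comp (continuous_const.sub continuous_id)).sub continuous_const).norm
  rw [normed_convolution_sub_self_eq φ hh x]
  have h1 : ‖∫ t, φ.normed volume t • (h (x - t) - h x)‖ ≤ ∫ t, φ.normed volume t * ‖h (x - t) - h x‖ := by
    refine (norm_integral_le_integral_norm _).trans (le_of_eq ?_)
    refine integral_congr_ae (Eventually.of_forall fun t ↦ ?_)
    simp only [norm_smul, Real.norm_eq_abs, abs_of_nonneg (φ.nonneg_normed t)]
  have hK0 : 0 ≤ ∫ t, φ.normed volume t * ‖h (x - t) - h x‖ :=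
    integral_nonneg fun t ↦ mul_nonneg (φ.nonneg_normed t) (norm_nonneg _)
  calc ‖∫ t, φ.normed volume t • (h (x - t) - h x)‖ ^ 2
      ≤ (∫ t, φ.normed volume t * ‖h (x - t) - h x‖) ^ 2 := pow_le_pow_left₀ (norm_nonneg _) h1 2
    _ ≤ (∫ t, φ.normed volume t) * ∫ t, φ.normed volume t * ‖h (x - t) - h x‖ ^ 2 :=
        sq_integral_weight_mul_le hρ hρc φ.nonneg_normed ha fun t ↦ norm_nonneg _
    _ = ∫ t, φ.normed volume t * ‖h (x - t) - h x‖ ^ 2 := by rw [φ.integral_normed, one_mul]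

omit [DecidableEq ι] in
/-- **The integrated mollification estimate, `ℝ≥0∞` form**:
`∫ ‖φ.normed ⋆ h − h‖² ≤ r_out² ∫ G²` (Tonelli, the translation estimate on `‖t‖ ≤ r_out`, unit
mass). [cite: Adams1975, Lemma 2.18] -/
theorem lintegral_enorm_normed_convolution_sub_self_sq_le (φ : ContDiffBump (0 : EuclideanSpace ℝ ι))
    {h : EuclideanSpace ℝ ι → W} (hh : ContDiff ℝ 1 h) :
    ∫⁻ x, ‖(φ.normed volume ⋆[lsmul ℝ ℝ, volume] h) x - h x‖ₑ ^ 2 ∂(volume : Measure (EuclideanSpace ℝ ι)) ≤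
      ENNReal.ofReal (φ.rOut ^ 2) *
        ∫⁻ x, ENNReal.ofReal (gradSum h x ^ 2) ∂(volume : Measure (EuclideanSpace ℝ ι)) := by
  set μ : Measure (EuclideanSpace ℝ ι) := volume with hμ
  set ρ : EuclideanSpace ℝ ι → ℝ := φ.normed μ with hρdef
  have hρ : Continuous ρ := (φ.contDiff_normed (n := 0)).continuous
  have hρ0 : ∀ t, 0 ≤ ρ t := φ.nonneg_normed
  have hhc : Continuous h := hh.continuous
  set I : ℝ≥0∞ := ∫⁻ x, ENNReal.ofReal (gradSum h x ^ 2) ∂μ with hI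
  -- pointwise in `ℝ≥0∞`
  have hpt : ∀ x, ‖(ρ ⋆[lsmul ℝ ℝ, μ] h) x - h x‖ₑ ^ 2 ≤
      ∫⁻ t, ENNReal.ofReal (ρ t) * ‖h (x - t) - h x‖ₑ ^ 2 ∂μ := by
    intro x
    have ha : Continuous fun t ↦ ‖h (x - t) - h x‖ :=
      ((hhc.comp (continuous_const.sub continuous_id)).sub continuous_const).norm
    have h1 := norm_normed_convolution_sub_self_sq_le φ hhc x
    have hint : Integrable (fun t ↦ ρ t * ‖h (x - t) - h x‖ ^ 2) μ :=
      ((hρ.mul (ha.pow 2))).integrable_of_hasCompactSupport (φ.hasCompactSupport_normed.mul_right)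
    rw [enorm_sq_eq_ofReal_norm_sq]
    calc ENNReal.ofReal (‖(ρ ⋆[lsmul ℝ ℝ, μ] h) x - h x‖ ^ 2)
        ≤ ENNReal.ofReal (∫ t, ρ t * ‖h (x - t) - h x‖ ^ 2 ∂μ) := ENNReal.ofReal_le_ofReal h1
      _ = ∫⁻ t, ENNReal.ofReal (ρ t * ‖h (x - t) - h x‖ ^ 2) ∂μ :=
          ofReal_integral_eq_lintegral_ofReal hint
            (Eventually.of_forall fun t ↦ mul_nonneg (hρ0 t) (sq_nonneg _))
      _ = ∫⁻ t, ENNReal.ofReal (ρ t) * ‖h (x - t) - h x‖ₑ ^ 2 ∂μ := by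
          refine lintegral_congr fun t ↦ ?_
          rw [ENNReal.ofReal_mul (hρ0 t), enorm_sq_eq_ofReal_norm_sq]
  -- integrate, swap, and use the translation estimate on the support
  have hmeas : AEMeasurable (uncurry fun (x t : EuclideanSpace ℝ ι) ↦
      ENNReal.ofReal (ρ t) * ‖h (x - t) - h x‖ₑ ^ 2) (μ.prod μ) := by
    have hc1 : Continuous fun p : EuclideanSpace ℝ ι × EuclideanSpace ℝ ι ↦ ENNReal.ofReal (ρ p.2) :=
      ENNReal.continuous_ofReal.comp (hρ.comp continuous_snd)
    have hc2 : Continuous fun p : EuclideanSpace ℝ ι × EuclideanSpace ℝ ι ↦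
        ‖h (p.1 - p.2) - h p.1‖ₑ ^ 2 :=
      (ENNReal.continuous_pow 2).comp
        (((hhc.comp (continuous_fst.sub continuous_snd)).sub (hhc.comp continuous_fst)).enorm)
    exact (hc1.measurable.mul hc2.measurable).aemeasurable
  have hsupp : ∀ t, ENNReal.ofReal (ρ t) * ENNReal.ofReal (‖t‖ ^ 2) ≤
      ENNReal.ofReal (ρ t) * ENNReal.ofReal (φ.rOut ^ 2) := by
    intro t
    by_cases ht : t ∈ support ρ
    · rw [hρdef, φ.support_normed_eq, mem_ball_zero_iff] at ht
      exact mul_le_mul_right (ENNReal.ofReal_le_ofReal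
        (pow_le_pow_left₀ (norm_nonneg _) ht.le 2)) _
    · rw [notMem_support.1 ht, ENNReal.ofReal_zero, zero_mul, zero_mul]
  have hmass : ∫⁻ t, ENNReal.ofReal (ρ t) ∂μ = 1 := by
    rw [← ofReal_integral_eq_lintegral_ofReal φ.integrable_normed (Eventually.of_forall hρ0),
      φ.integral_normed, ENNReal.ofReal_one]
  calc ∫⁻ x, ‖(ρ ⋆[lsmul ℝ ℝ, μ] h) x - h x‖ₑ ^ 2 ∂μ
      ≤ ∫⁻ x, ∫⁻ t, ENNReal.ofReal (ρ t) * ‖h (x - t) - h x‖ₑ ^ 2 ∂μ ∂μ := lintegral_mono hpt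
    _ = ∫⁻ t, ∫⁻ x, ENNReal.ofReal (ρ t) * ‖h (x - t) - h x‖ₑ ^ 2 ∂μ ∂μ :=
        lintegral_lintegral_swap hmeas
    _ = ∫⁻ t, ENNReal.ofReal (ρ t) * ∫⁻ x, ‖h (x - t) - h x‖ₑ ^ 2 ∂μ ∂μ := by
        refine lintegral_congr fun t ↦ ?_
        rw [lintegral_const_mul' _ _ ENNReal.ofReal_ne_top]
    _ ≤ ∫⁻ t, ENNReal.ofReal (ρ t) * (ENNReal.ofReal (‖t‖ ^ 2) * I) ∂μ :=
        lintegral_mono fun t ↦ mul_le_mul_right (lintegral_enorm_sub_translate_sq_le hh t) _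
    _ ≤ ∫⁻ t, ENNReal.ofReal (ρ t) * (ENNReal.ofReal (φ.rOut ^ 2) * I) ∂μ := by
        refine lintegral_mono fun t ↦ ?_
        rw [← mul_assoc, ← mul_assoc]
        exact mul_le_mul_left (hsupp t) _
    _ = (∫⁻ t, ENNReal.ofReal (ρ t) ∂μ) * (ENNReal.ofReal (φ.rOut ^ 2) * I) := by
        rw [lintegral_mul_const'' _ (hρ.measurable.ennreal_ofReal).aemeasurable]
    _ = ENNReal.ofReal (φ.rOut ^ 2) * I := by rw [hmass, one_mul]

omit [DecidableEq ι] in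
/-- **The rate of mollification** (Adams 1975, Lemma 2.18 / Thm. 2.29; Evans, *PDE*, §5.8.2): for
a bump `φ` centred at `0` and `h ∈ C¹(ℝⁿ; W)` with square-integrable partial derivatives, the
mollification error `φ.normed ⋆ h − h` is in `L²` with
`‖φ.normed ⋆ h − h‖₂ ≤ φ.rOut · Σⱼ ‖∂ⱼ h‖₂`. [cite: Adams1975, Lemma 2.18] -/
theorem l2norm_normed_convolution_sub_self_le (φ : ContDiffBump (0 : EuclideanSpace ℝ ι))
    {h : EuclideanSpace ℝ ι → W} (hh : ContDiff ℝ 1 h)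
    (hL2 : ∀ j, MemLp (fun y ↦ fderiv ℝ h y (bv j)) 2 (volume : Measure (EuclideanSpace ℝ ι))) :
    MemLp (fun x ↦ (φ.normed volume ⋆[lsmul ℝ ℝ, volume] h) x - h x) 2
        (volume : Measure (EuclideanSpace ℝ ι)) ∧
      l2norm (fun x ↦ (φ.normed volume ⋆[lsmul ℝ ℝ, volume] h) x - h x) ≤
        φ.rOut * ∑ j, l2norm (fun y ↦ fderiv ℝ h y (bv j)) := by
  set μ : Measure (EuclideanSpace ℝ ι) := volume with hμ
  have h1 := lintegral_enorm_normed_convolution_sub_self_sq_le φ hh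
  rw [lintegral_ofReal_gradSum_sq] at h1
  set Δ : EuclideanSpace ℝ ι → W := fun x ↦ (φ.normed μ ⋆[lsmul ℝ ℝ, μ] h) x - h x with hΔ
  have hsq : eLpNorm Δ 2 μ ^ 2 ≤ (ENNReal.ofReal φ.rOut * eLpNorm (gradSum h) 2 μ) ^ 2 := by
    have h2 : eLpNorm Δ 2 μ ^ ((2 : ℝ≥0) : ℝ) = ∫⁻ x, ‖Δ x‖ₑ ^ ((2 : ℝ≥0) : ℝ) ∂μ :=
      eLpNorm_nnreal_pow_eq_lintegral two_ne_zero
    have h2' : ((2 : ℝ≥0) : ℝ) = 2 := by norm_num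
    rw [h2'] at h2
    simp only [ENNReal.rpow_two] at h2
    rw [h2, mul_pow, ← ENNReal.ofReal_pow φ.rOut_pos.le]
    exact h1
  have hle : eLpNorm Δ 2 μ ≤ ENNReal.ofReal φ.rOut *
      ∑ j, eLpNorm (fun y ↦ fderiv ℝ h y (bv j)) 2 μ :=
    (ENNReal.le_of_sq_le_sq hsq).trans (mul_le_mul_right (eLpNorm_gradSum_le hh) _)
  -- finiteness and the real form
  have hfin : ∑ j, eLpNorm (fun y ↦ fderiv ℝ h y (bv j)) 2 μ < ⊤ :=
    ENNReal.sum_lt_top.2 fun j _ ↦ (hL2 j).eLpNorm_lt_top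
  have hΔc : Continuous Δ := by
    have hconv : ContDiff ℝ 1 (φ.normed μ ⋆[lsmul ℝ ℝ, μ] h) :=
      φ.hasCompactSupport_normed.contDiff_convolution_left _ φ.contDiff_normed
        (hh.continuous.locallyIntegrable)
    exact hconv.continuous.sub hh.continuous
  have hmem : MemLp Δ 2 μ :=
    ⟨hΔc.aestronglyMeasurable, hle.trans_lt (ENNReal.mul_lt_top ENNReal.ofReal_lt_top hfin)⟩
  refine ⟨hmem, ?_⟩
  rw [l2norm_def]
  have hne : ∀ j ∈ (Finset.univ : Finset ι), eLpNorm (fun y ↦ fderiv ℝ h y (bv j)) 2 μ ≠ ⊤ :=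
    fun j _ ↦ (hL2 j).eLpNorm_ne_top
  calc (eLpNorm Δ 2 μ).toReal
      ≤ (ENNReal.ofReal φ.rOut * ∑ j, eLpNorm (fun y ↦ fderiv ℝ h y (bv j)) 2 μ).toReal :=
        ENNReal.toReal_mono (ENNReal.mul_ne_top ENNReal.ofReal_ne_top hfin.ne) hle
    _ = φ.rOut * ∑ j, l2norm (fun y ↦ fderiv ℝ h y (bv j)) := by
        rw [ENNReal.toReal_mul, ENNReal.toReal_ofReal φ.rOut_pos.le, ENNReal.toReal_sum hne]
        rfl

/-! ### Sup-norm companions -/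

omit [DecidableEq ι] in
/-- **Sup-norm contraction**: if `‖h‖ ≤ K` on the ball of radius `φ.rOut` around `x`, then
`‖(φ.normed ⋆ h)(x)‖ ≤ K`. [cite: Evans2010, App. C.4 Thm. 7] -/
theorem norm_normed_convolution_le (φ : ContDiffBump (0 : EuclideanSpace ℝ ι))
    {h : EuclideanSpace ℝ ι → W} (hh : Continuous h) {x : EuclideanSpace ℝ ι} {K : ℝ}
    (hK : ∀ y ∈ ball x φ.rOut, ‖h y‖ ≤ K) :
    ‖(φ.normed volume ⋆[lsmul ℝ ℝ, volume] h) x‖ ≤ K := by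
  have hK0 : 0 ≤ K := (norm_nonneg _).trans (hK x (mem_ball_self φ.rOut_pos))
  have h := dist_convolution_le (μ := (volume : Measure (EuclideanSpace ℝ ι)))
    (f := φ.normed volume) (g := h) (x₀ := x) (z₀ := (0 : W)) (ε := K) hK0
    φ.support_normed_eq.subset φ.nonneg_normed φ.integral_normed hh.aestronglyMeasurable
    (fun y hy ↦ by rw [dist_zero_right]; exact hK y hy)
  rwa [dist_zero_right] at h

omit [DecidableEq ι] in
/-- **Sup-norm rate**: if `h ∈ C¹` with `‖Dh‖ ≤ K` on the ball of radius `φ.rOut` around `x`, then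
`‖(φ.normed ⋆ h)(x) − h(x)‖ ≤ φ.rOut · K` (mean value inequality and
`ContDiffBump.dist_normed_convolution_le`). [cite: Evans2010, App. C.4 Thm. 7] -/
theorem norm_normed_convolution_sub_self_le (φ : ContDiffBump (0 : EuclideanSpace ℝ ι))
    {h : EuclideanSpace ℝ ι → W} (hh : ContDiff ℝ 1 h) {x : EuclideanSpace ℝ ι} {K : ℝ}
    (hK : ∀ y ∈ ball x φ.rOut, ‖fderiv ℝ h y‖ ≤ K) :
    ‖(φ.normed volume ⋆[lsmul ℝ ℝ, volume] h) x - h x‖ ≤ φ.rOut * K := by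
  have hmvt : ∀ y ∈ ball x φ.rOut, dist (h y) (h x) ≤ φ.rOut * K := by
    intro y hy
    have hconv : Convex ℝ (ball x φ.rOut) := convex_ball x φ.rOut
    have hd : ∀ z ∈ ball x φ.rOut, DifferentiableAt ℝ h z := fun z _ ↦
      hh.differentiable one_ne_zero z
    have h1 := hconv.norm_image_sub_le_of_norm_fderiv_le (fun z hz ↦ hd z hz) hK
      (mem_ball_self φ.rOut_pos) hy
    rw [dist_eq_norm]
    calc ‖h y - h x‖ ≤ K * ‖y - x‖ := h1
      _ ≤ K * φ.rOut := by
          have hK0 : 0 ≤ K := (norm_nonneg _).trans (hK x (mem_ball_self φ.rOut_pos))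
          exact mul_le_mul_of_nonneg_left (le_of_lt (by rwa [mem_ball, dist_eq_norm] at hy)) hK0
      _ = φ.rOut * K := mul_comm _ _
  have h := φ.dist_normed_convolution_le (μ := (volume : Measure (EuclideanSpace ℝ ι)))
    hh.continuous.aestronglyMeasurable hmvt
  rwa [dist_eq_norm] at h

end Mollify

end Literature.Analysis.PDE

end
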